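import Literature.AlgebraicGeometry.Resolution.AlterationsLemma411VertexProjection
import Literature.AlgebraicGeometry.Resolution.PointBlowupProjectionRingHom
import Mathlib.Algebra.MvPolynomial.Equiv
import HarnessLib

/-!
# The linear projection from the vertex is smooth on the charts: `(k[y]_{(yᵢ)})₀ → (k[x]_{(xᵢ)})₀` is a polynomial algebra

Topic: `Literature/AlgebraicGeometry/Resolution`. Commutative algebra for the construction of
de Jong 1996, proof of Lemma 4.11 (p. 68): on the chart `D₊(xᵢ) ⊆ ℙ^{d+1}`, `i ≤ d`, the linear
projection from the vertex `pr_p : (x₀ : … : x_{d+1}) ↦ (x₀ : … : x_d)` is `Spec` of the ring map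
`(k[y₀, …, y_d]_{(yᵢ)})₀ → (k[x₀, …, x_{d+1}]_{(xᵢ)})₀`, `y_a/yᵢ ↦ x_a/xᵢ`
(`DeJong1996.vertexProjectionRingHom`, `AlterationsLemma411Vertex.lean`). Dehomogenised
(`PointBlowup.awayBaseEquiv`: `(k[y]_{(yᵢ)})₀ ≅ k[Y_a : a ≠ i]`, `(k[x]_{(xᵢ)})₀ ≅ k[X_a : a ≠ i]`),
it is the inclusion of polynomial rings `k[Y_a : a ≠ i] → k[X_{a'} : a' ≠ i]`, `Y_a ↦ X_a`, whose
image misses exactly the variable `X_{d+1} = x_{d+1}/xᵢ`: the target is the polynomial ring in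
one variable over the source. PROVED here:

* `DeJong1996.optionIndexEquiv d i : Option {a // a ≠ i} ≃ {a' : Fin (d + 2) // a' ≠ i}` (`none ↦
  d + 1`, `some a ↦ a`) and `DeJong1996.basePolyEquiv : k[X_{a'} : a' ≠ i] ≅ (k[Y_a : a ≠ i])[T]`
  with `X_a ↦ C(Y_a)`, `X_{d+1} ↦ T`;
* `DeJong1996.baseIncl` — the inclusion `Y_a ↦ X_a`, equal to `basePolyEquiv⁻¹ ∘ C`
  (`baseIncl_eq`), hence smooth (`smooth_baseIncl`);
* `DeJong1996.vertexProjectionRingHom_eq` — `vertexProjectionRingHom` is `baseIncl` conjugated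
  by the dehomogenisation isomorphisms, and **`DeJong1996.smooth_vertexProjectionRingHom`**: the
  linear projection from the vertex is a smooth ring map on each chart — `pr_p : ℙ^{d+1} ∖ {p} → ℙ^d`
  is smooth (an `𝔸¹`-bundle), the part of "`q : P̃ → ℙ^d` is smooth" off the exceptional divisor.

No named facts; [folklore] throughout.

## Sources

* A. J. de Jong, *Smoothness, semi-stability and alterations*, Publ. Math. IHÉS 83 (1996),
  proof of Lemma 4.11, p. 68 (the projection `pr_p`). [DeJong1996]
* R. Hartshorne, *Algebraic Geometry* (1977), I Thm. 3.4 (proof), II Prop. 2.5 (b).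
  [Hartshorne1977]
-/

noncomputable section

open HomogeneousLocalization

attribute [local instance] MvPolynomial.gradedAlgebra
  Literature.AlgebraicGeometry.Motives.ProjBaseChange.algebraBase
  Literature.AlgebraicGeometry.Motives.ProjBaseChange.isScalarTower_localization

namespace Literature.AlgebraicGeometry.Resolution

universe u

open Literature.AlgebraicGeometry.Motives.Segre (grading cst frac X_mem frac_self)

namespace DeJong1996

variable (d : ℕ) (k : Type u) [Field k] (i : Fin (d + 1))

/-! ## Reindexing: the variables of `k[X_{a'} : a' ≠ i]` are those of `k[Y_a : a ≠ i]` and `X_{d+1}` -/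

/-- The embedding of index sets `{a : Fin (d+1) // a ≠ i} → {a' : Fin (d+2) // a' ≠ i}`, `a ↦ a`.
[folklore] -/
def csEmb (a : {a : Fin (d + 1) // a ≠ i}) : {a' : Fin (d + 1 + 1) // a' ≠ Fin.castSucc i} :=
  ⟨Fin.castSucc a.1, fun h => a.2 (Fin.castSucc_injective _ h)⟩

/-- `csEmb a` is the index `a`. [folklore] -/
@[simp]
theorem coe_csEmb (a : {a : Fin (d + 1) // a ≠ i}) : (csEmb d i a : Fin (d + 1 + 1)) = Fin.castSucc a.1 :=
  rfl

/-- **`Option {a // a ≠ i} ≃ {a' : Fin (d + 2) // a' ≠ i}`**: `none ↦ d + 1`, `some a ↦ a`.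
[folklore] -/
def optionIndexEquiv : Option {a : Fin (d + 1) // a ≠ i} ≃ {a' : Fin (d + 1 + 1) // a' ≠ Fin.castSucc i} where
  toFun o := o.elim ⟨Fin.last (d + 1), (Fin.castSucc_lt_last i).ne'⟩ (csEmb d i)
  invFun a' := if h : (a' : Fin (d + 1 + 1)) = Fin.last (d + 1) then none
    else some ⟨(a' : Fin (d + 1 + 1)).castPred h, fun h2 => a'.2 (by
      have := congrArg Fin.castSucc h2
      rwa [Fin.castSucc_castPred] at this)⟩
  left_inv o := by
    cases o with
    | none => simp
    | some a =>
      simp only [Option.elim_some, coe_csEmb, (Fin.castSucc_lt_last a.1).ne, ↓reduceDIte,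
        Fin.castPred_castSucc, Subtype.coe_eta]
  right_inv a' := by
    by_cases h : (a' : Fin (d + 1 + 1)) = Fin.last (d + 1)
    · simp only [h, ↓reduceDIte, Option.elim_none]
      exact Subtype.ext h.symm
    · simp only [h, ↓reduceDIte, Option.elim_some]
      exact Subtype.ext (Fin.castSucc_castPred _ h)

/-- `optionIndexEquiv (some a) = a`. [folklore] -/
@[simp]
theorem optionIndexEquiv_some (a : {a : Fin (d + 1) // a ≠ i}) :
    optionIndexEquiv d i (some a) = csEmb d i a :=
  rfl

/-- `optionIndexEquiv none = d + 1`. [folklore] -/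
@[simp]
theorem coe_optionIndexEquiv_none :
    (optionIndexEquiv d i none : Fin (d + 1 + 1)) = Fin.last (d + 1) :=
  rfl

/-! ## `k[X_{a'} : a' ≠ i] ≅ (k[Y_a : a ≠ i])[T]` and the inclusion `Y_a ↦ X_a` -/

/-- **`k[X_{a'} : a' ≠ i] ≅ (k[Y_a : a ≠ i])[T]`**, `X_a ↦ C(Y_a)` (`a ≤ d`), `X_{d+1} ↦ T`
(reindex along `optionIndexEquiv`, then Mathlib's `MvPolynomial.optionEquivLeft`). [folklore] -/
def basePolyEquiv : PointBlowup.Base (d + 1) k (Fin.castSucc i) ≃+* Polynomial (PointBlowup.Base d k i) :=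
  (MvPolynomial.renameEquiv k (optionIndexEquiv d i).symm).toRingEquiv.trans
    (MvPolynomial.optionEquivLeft k {a : Fin (d + 1) // a ≠ i}).toRingEquiv

/-- `basePolyEquiv (X_a) = C(Y_a)`. [folklore] -/
theorem basePolyEquiv_X_csEmb (a : {a : Fin (d + 1) // a ≠ i}) :
    basePolyEquiv d k i (MvPolynomial.X (csEmb d i a)) = Polynomial.C (MvPolynomial.X a) := by
  rw [basePolyEquiv, RingEquiv.trans_apply]
  change MvPolynomial.optionEquivLeft k _ (MvPolynomial.renameEquiv k (optionIndexEquiv d i).symm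
    (MvPolynomial.X (csEmb d i a))) = _
  rw [MvPolynomial.renameEquiv_apply, MvPolynomial.rename_X, ← optionIndexEquiv_some,
    Equiv.symm_apply_apply, MvPolynomial.optionEquivLeft_X_some]

/-- `basePolyEquiv` on constants. [folklore] -/
theorem basePolyEquiv_C (c : k) :
    basePolyEquiv d k i (MvPolynomial.C c) = Polynomial.C (MvPolynomial.C c) := by
  rw [basePolyEquiv, RingEquiv.trans_apply]
  change MvPolynomial.optionEquivLeft k _ (MvPolynomial.renameEquiv k (optionIndexEquiv d i).symm
    (MvPolynomial.C c)) = _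
  rw [MvPolynomial.renameEquiv_apply, MvPolynomial.rename_C, MvPolynomial.optionEquivLeft_C]

/-- **The inclusion `k[Y_a : a ≠ i] → k[X_{a'} : a' ≠ i]`, `Y_a ↦ X_a`** — the dehomogenised
projection from the vertex on the chart. [folklore] -/
def baseIncl : PointBlowup.Base d k i →+* PointBlowup.Base (d + 1) k (Fin.castSucc i) :=
  (MvPolynomial.rename (csEmb d i) : PointBlowup.Base d k i →ₐ[k] _).toRingHom

/-- `baseIncl (Y_a) = X_a`. [folklore] -/
@[simp]
theorem baseIncl_X (a : {a : Fin (d + 1) // a ≠ i}) :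
    baseIncl d k i (MvPolynomial.X a) = MvPolynomial.X (csEmb d i a) := by
  simp [baseIncl]

/-- `baseIncl` on constants. [folklore] -/
@[simp]
theorem baseIncl_C (c : k) : baseIncl d k i (MvPolynomial.C c) = MvPolynomial.C c := by
  simp [baseIncl]

/-- Through `basePolyEquiv` the inclusion is `C : B → B[T]`. [folklore] -/
theorem basePolyEquiv_comp_baseIncl :
    (basePolyEquiv d k i).toRingHom.comp (baseIncl d k i) = Polynomial.C := by
  refine MvPolynomial.ringHom_ext (fun c => ?_) (fun a => ?_)
  · rw [RingHom.comp_apply, baseIncl_C, RingEquiv.toRingHom_eq_coe, RingEquiv.coe_toRingHom,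
      basePolyEquiv_C]
  · rw [RingHom.comp_apply, baseIncl_X, RingEquiv.toRingHom_eq_coe, RingEquiv.coe_toRingHom,
      basePolyEquiv_X_csEmb]

/-- `baseIncl = basePolyEquiv⁻¹ ∘ C`: the target is the polynomial ring in one variable over
the source. [folklore] -/
theorem baseIncl_eq :
    baseIncl d k i = (basePolyEquiv d k i).symm.toRingHom.comp Polynomial.C := by
  rw [← basePolyEquiv_comp_baseIncl, ← RingHom.comp_assoc, RingEquiv.symm_toRingHom_comp_toRingHom,
    RingHom.id_comp]

/-- `B[T]` is a smooth `B`-algebra. [folklore] -/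
instance smooth_polynomial (B : Type u) [CommRing B] : Algebra.Smooth B (Polynomial B) where

/-- **The inclusion `Y_a ↦ X_a` is a smooth ring map** (`B → B[T]` followed by an isomorphism).
[folklore] -/
theorem smooth_baseIncl : (baseIncl d k i).Smooth := by
  rw [baseIncl_eq]
  exact RingHom.Smooth.comp (RingHom.smooth_algebraMap.mpr inferInstance)
    (RingHom.Smooth.of_bijective (basePolyEquiv d k i).symm.bijective)

/-! ## The projection from the vertex on the charts -/

/-- **`vertexProjectionRingHom` dehomogenised is the inclusion `Y_a ↦ X_a`**:
`vertexProjectionRingHom = awayBaseEquiv⁻¹ ∘ baseIncl ∘ awayBaseEquiv` (both sides agree on the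
constants and on the `y_a/yᵢ`). [folklore] -/
theorem vertexProjectionRingHom_eq :
    vertexProjectionRingHom d k i =
      (PointBlowup.awayBaseEquiv (d + 1) k (Fin.castSucc i)).symm.toRingHom.comp
        ((baseIncl d k i).comp (PointBlowup.awayBaseEquiv d k i).toRingHom) := by
  apply awayRingHom_ext k
  · rw [vertexProjectionRingHom_comp_cst]
    refine RingHom.ext fun c => ?_
    simp only [RingHom.comp_apply, RingEquiv.toRingHom_eq_coe, RingEquiv.coe_toRingHom]
    rw [PointBlowup.awayBaseEquiv_cst, baseIncl_C, ← PointBlowup.awayBaseEquiv_cst (d + 1) k (Fin.castSucc i) c,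
      RingEquiv.symm_apply_apply]
  · intro a
    rw [vertexProjectionRingHom_frac]
    simp only [RingHom.comp_apply, RingEquiv.toRingHom_eq_coe, RingEquiv.coe_toRingHom]
    by_cases ha : a = i
    · subst ha
      rw [frac_self, frac_self, map_one, map_one, map_one]
    · rw [PointBlowup.awayBaseEquiv_frac d k i ha, baseIncl_X]
      change _ = (PointBlowup.awayBaseEquiv (d + 1) k (Fin.castSucc i)).symm
        (MvPolynomial.X ⟨Fin.castSucc a, fun h => ha (Fin.castSucc_injective _ h)⟩)
      rw [← PointBlowup.awayBaseEquiv_frac (d + 1) k (Fin.castSucc i) (a := Fin.castSucc a)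
          (fun h => ha (Fin.castSucc_injective _ h)),
        RingEquiv.symm_apply_apply]

/-- **The linear projection from the vertex is a smooth ring map on the chart `D₊(xᵢ)`**,
`i ≤ d`: `(k[y]_{(yᵢ)})₀ → (k[x]_{(xᵢ)})₀`, `y_a/yᵢ ↦ x_a/xᵢ`, is smooth (`pr_p` is an
`𝔸¹`-bundle off the vertex). [cite: DeJong1996, Lemma 4.11 (proof), p. 68] -/
theorem smooth_vertexProjectionRingHom : (vertexProjectionRingHom d k i).Smooth := by
  rw [vertexProjectionRingHom_eq]
  exact RingHom.Smooth.comp (RingHom.Smooth.comp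
    (RingHom.Smooth.of_bijective (PointBlowup.awayBaseEquiv d k i).bijective) (smooth_baseIncl d k i))
    (RingHom.Smooth.of_bijective (PointBlowup.awayBaseEquiv (d + 1) k (Fin.castSucc i)).symm.bijective)

end DeJong1996

end Literature.AlgebraicGeometry.Resolution

end
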